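import Summits.CriticalPhenomena.PercolationContinuityZ3.Theorems.PercNearOneGluingNoHeavyLowerTailMajorityGluingTypeTableScaledLaw
import HarnessLib

/-!
# Template S in the kernel: template B's ISO tangent rows hold for the scaled law
(lane prim-rate, constants-miner 1, gen 30; RIGOROUS-CERTIFICATION.md §4 «THE SCALING»; KERNEL-WINDOW.md §4 (1))

Support file for the closed crux `NoHeavyLowerTail` (stmt-CriticalPhenomena-4575), majority-gluing line; continuation of
`…TypeTableScaledLaw` (`SLaw`, `xs`, `scal`) and `…TypeTableFixedMSupp` / `…TypeTableFixedMIso` (`cut_sound`, the support bounds).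
THE SCALING STEP: a power row `u^c ≤ M^b·F·s·t` of the law `x` (bounded factor `F ≤ R`, two supports) becomes, for the scaled
law `x̂ = Λx`, `Λ = (M_top/M)^{s₀}`, the row `û^c ≤ M_top^b·F·ŝ·t̂` AT THE FIXED HUB WEIGHT `M_top = 2^{-K/32}` as soon as
`s₀·(c − 2) ≤ b` (`scaled_row`) — which holds for all five kinds: hub/relay ISO₃ (`c₃ − 2` against `3 − c₃`: `s₀ < √3`), ISO₄ /
hub ISO₄ (`c₄ − 2` against `4 − c₄`) and ISO₅ (`1/2` against `5/2`).  Hence every tangent row of template B checked by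
`TRow.ok K` holds for `x̂` (`trow_valid_scaled`; the restricted version `tan_valid` is in `…TypeTableScaledStar`).  No percolation, no sorries.  [cite: VandenbergHaggstromKahn2005, Thm. 1.3 (p. 6)]
-/

namespace Summit.CriticalPhenomena.PercolationContinuityZ3.Theorems

namespace HubOnly
namespace TypeTable

open DType

noncomputable section

/-! ### Numerical facts about `s₀` -/

/-- `s₀ ≤ 1.6862` (from the bracket of `1/c₄`). -/
theorem s0_le : s0 ≤ 16862 / 10000 := by
  obtain ⟨h1, h2⟩ := RpowCert.inv_c4_bounds
  have e : (1 : ℝ) / C4r = ((3 + Real.sqrt (11 / 3)) / 2)⁻¹ := one_div _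
  unfold s0
  rw [e]
  have hd : 0 < 2 - 4 * ((3 + Real.sqrt (11 / 3)) / 2)⁻¹ := by linarith
  rw [div_le_iff₀ hd]
  linarith

/-- The three exponent conditions of the scaling step: `s₀(c₃−2) ≤ 3−c₃`, `s₀(c₄−2) ≤ 4−c₄`, `s₀(5/2−2) ≤ 5/2`. -/
theorem s0_exponents :
    s0 * ((3 + Real.sqrt 3) / 2 - 2) ≤ 3 - (3 + Real.sqrt 3) / 2 ∧
    s0 * ((3 + Real.sqrt (11 / 3)) / 2 - 2) ≤ 4 - (3 + Real.sqrt (11 / 3)) / 2 ∧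
    s0 * ((5 : ℝ) / 2 - 2) ≤ (5 : ℝ) / 2 := by
  have hs := s0_le
  have hs0 : 0 ≤ s0 := le_trans zero_le_one one_lt_s0'.le
  obtain ⟨a1, a2⟩ := RpowCert.sqrt3_bounds
  obtain ⟨b1, b2⟩ := RpowCert.sqrt_11_3_bounds
  refine ⟨?_, ?_, by nlinarith⟩
  · have hc : 0 ≤ (3 + Real.sqrt 3) / 2 - 2 := by linarith
    calc s0 * ((3 + Real.sqrt 3) / 2 - 2) ≤ 16862 / 10000 * ((3 + Real.sqrt 3) / 2 - 2) :=
          mul_le_mul_of_nonneg_right hs hc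
      _ ≤ _ := by nlinarith
  · have hc : 0 ≤ (3 + Real.sqrt (11 / 3)) / 2 - 2 := by linarith
    calc s0 * ((3 + Real.sqrt (11 / 3)) / 2 - 2) ≤ 16862 / 10000 * ((3 + Real.sqrt (11 / 3)) / 2 - 2) :=
          mul_le_mul_of_nonneg_right hs hc
      _ ≤ _ := by nlinarith

/-! ### The scaling step -/

variable {K : ℕ} {M : ℝ} {x : DType → ℝ} {cs : SCase}

/-- **SCALING STEP.**  `u^c ≤ M^b·F·s·t`, `0 < M ≤ M_top`, `s₀(c−2) ≤ b` ⟹ `(Λu)^c ≤ M_top^b·F·(Λs)·(Λt)`, `Λ = (M_top/M)^{s₀}`. -/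
theorem scaled_row {u s t F b c : ℝ} (hM : 0 < M) (hMle : M ≤ Mtop K) (hexp : s0 * (c - 2) ≤ b)
    (hu : 0 ≤ u) (hs : 0 ≤ s) (ht : 0 ≤ t) (hF : 0 ≤ F) (row : u ^ c ≤ M ^ b * F * s * t) :
    (scal K M * u) ^ c ≤ Mtop K ^ b * F * (scal K M * s) * (scal K M * t) := by
  obtain ⟨hl1, -, hLpos⟩ := scal_facts (K := K) hM hMle
  have hlampos : 0 < Mtop K / M := lt_of_lt_of_le zero_lt_one hl1
  have hL : scal K M = (Mtop K / M) ^ s0 := rfl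
  have hMb : 0 ≤ M ^ b := Real.rpow_nonneg hM.le b
  have hP0 : 0 ≤ M ^ b * F * s * t := mul_nonneg (mul_nonneg (mul_nonneg hMb hF) hs) ht
  have e1 : (scal K M * u) ^ c = (Mtop K / M) ^ (s0 * c) * u ^ c := by
    rw [Real.mul_rpow hLpos.le hu, hL, ← Real.rpow_mul hlampos.le]
  have e2 : Mtop K ^ b = (Mtop K / M) ^ b * M ^ b := by
    rw [← Real.mul_rpow hlampos.le hM.le, div_mul_cancel₀ _ (ne_of_gt hM)]
  have e3 : Mtop K ^ b * F * (scal K M * s) * (scal K M * t) = (Mtop K / M) ^ (2 * s0 + b) * (M ^ b * F * s * t) := by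
    rw [e2, hL, show 2 * s0 + b = s0 + s0 + b by ring, Real.rpow_add hlampos, Real.rpow_add hlampos]; ring
  have step1 : (Mtop K / M) ^ (s0 * c) * u ^ c ≤ (Mtop K / M) ^ (s0 * c) * (M ^ b * F * s * t) :=
    mul_le_mul_of_nonneg_left row (Real.rpow_nonneg hlampos.le _)
  have step2 : (Mtop K / M) ^ (s0 * c) ≤ (Mtop K / M) ^ (2 * s0 + b) :=
    Real.rpow_le_rpow_of_exponent_le hl1 (by nlinarith [hexp])
  rw [e1, e3]
  exact step1.trans (mul_le_mul_of_nonneg_right step2 hP0)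

/-- **The cut of a scaled power row**: the unscaled row of `x`, the scaling step and `cut_sound` at `M_top`. -/
theorem scut {u s t F R b c : ℝ} {Cu Pu QL QU H : ℚ} {i j : ℤ} {N G1 G2 : ℕ}
    (hM : 0 < M) (hMle : M ≤ Mtop K) (hc : 0 < c) (hexp : s0 * (c - 2) ≤ b)
    (hu : 0 ≤ u) (hs : 0 ≤ s) (ht : 0 ≤ t) (hF : 0 ≤ F) (hFR : F ≤ R)
    (hql : (QL : ℝ) ≤ c⁻¹) (hqu : c⁻¹ ≤ (QU : ℝ)) (hq2 : 2 * c⁻¹ ≤ 1)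
    (row : u ^ c ≤ M ^ b * F * s * t) (hC : (Mtop K ^ b * R) ^ c⁻¹ ≤ (Cu : ℝ))
    (hP : ((2 : ℝ) ^ ((i : ℝ) / 32) * (2 : ℝ) ^ ((j : ℝ) / 32)) ^ c⁻¹ ≤ (Pu : ℝ)) (hN : 0 < N)
    (c1 : Cu * Pu * (1 - 2 * QL) ≤ H / N) (c2 : Cu * QU * Pu * powUp ETAL ETAU (-i) ≤ (G1 : ℚ) / N)
    (c3 : Cu * QU * Pu * powUp ETAL ETAU (-j) ≤ (G2 : ℚ) / N) :
    (N : ℝ) * (scal K M * u) + -(G1 : ℝ) * (scal K M * s) + -(G2 : ℝ) * (scal K M * t) ≤ H := by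
  obtain ⟨-, -, hLpos⟩ := scal_facts (K := K) hM hMle
  exact cut_sound (mul_nonneg hLpos.le hu) (Real.rpow_nonneg (Mtop_pos K).le b) hF hFR (mul_nonneg hLpos.le hs)
    (mul_nonneg hLpos.le ht) hc hql hqu hq2 (scaled_row hM hMle hexp hu hs ht hF row) hC hP hN c1 c2 c3

/-- Masses of the unrestricted scaled law: `lin φ x̂ = Λ·lin φ x`. -/
theorem lin_xs (φ : DType → ℤ) (w : ℕ) : lin φ (xs false K M w x) = scal K M * lin φ x := by
  rw [xs_false, lin_smul]

/-! ### The five tangent kinds for the scaled law -/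

/-- Hub ISO₃ cut for the scaled law. -/
theorem stan_hub3 (L : SLaw K cs M x) {a b : ℕ} (ha : a ∈ [1, 2, 3, 4]) (hb : b ∈ [1, 2, 3, 4]) (hab : a < b)
    {i j : ℤ} {N G1 G2 : ℕ} {H : ℚ} (hN : 0 < N)
    (c1 : (PKind.hub3 a b).Cu K * powUp TH3L TH3U (i + j) * (1 - 2 * QL3) ≤ H / N)
    (c2 : (PKind.hub3 a b).Cu K * QU3 * powUp TH3L TH3U (i + j) * powUp ETAL ETAU (-i) ≤ (G1 : ℚ) / N)
    (c3 : (PKind.hub3 a b).Cu K * QU3 * powUp TH3L TH3U (i + j) * powUp ETAL ETAU (-j) ≤ (G2 : ℚ) / N) :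
    (N : ℝ) * uS [0, a, b] (xs false K M cs.w x) + -(G1 : ℝ) * Pim a b (xs false K M cs.w x) +
      -(G2 : ℝ) * Pim b a (xs false K M cs.w x) ≤ H := by
  have hx := L.nonneg
  obtain ⟨hB2, hB3, hB4⟩ := L.budgets
  obtain ⟨hc, hql, hqu, hq2, hn⟩ := c3_facts
  simp only [uS, Pim, lin_xs]
  have hC : (Mtop K ^ (3 - (3 + Real.sqrt 3) / 2) * 1) ^ ((3 + Real.sqrt 3) / 2)⁻¹ ≤ (((PKind.hub3 a b).Cu K : ℚ) : ℝ) := by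
    rw [mul_one]
    have h := scaled_const_le (n := 3) (Mtop_pos K) le_rfl hc hn (by decide +kernel) theta3_bounds.1 theta3_bounds.2 (k := K)
    simp only [PKind.Cu]
    exact_mod_cast h
  exact scut L.Mpos L.Mle hc s0_exponents.1 (lin_ind_nonneg _ hx) (lin_ind_nonneg _ hx) (lin_ind_nonneg _ hx)
    (lin_ind_nonneg _ hx) (rho0_le_one x hx L.norm hB2 hB3 hB4 a ha b hb (Nat.ne_of_lt hab)) hql hqu hq2
    (L.isoH a ha b hb (Nat.ne_of_lt hab)) hC (supp_pow_le (by decide +kernel) theta3_bounds.1 theta3_bounds.2 i j) hN c1 c2 c3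

/-- Relay ISO₃ cut for the scaled law (support `ρ_f ≤ 2`). -/
theorem stan_rel3 (L : SLaw K cs M x) {a b c f : ℕ} (ha : a ∈ [1, 2, 3, 4]) (hb : b ∈ [1, 2, 3, 4])
    (hc' : c ∈ [1, 2, 3, 4]) (hab : a < b) (hbc : b < c) (hf : f = a ∨ f = b ∨ f = c)
    {i j : ℤ} {N G1 G2 : ℕ} {H : ℚ} (hN : 0 < N)
    (c1 : (PKind.rel3 a b c f).Cu K * powUp TH3L TH3U (i + j) * (1 - 2 * QL3) ≤ H / N)
    (c2 : (PKind.rel3 a b c f).Cu K * QU3 * powUp TH3L TH3U (i + j) * powUp ETAL ETAU (-i) ≤ (G1 : ℚ) / N)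
    (c3 : (PKind.rel3 a b c f).Cu K * QU3 * powUp TH3L TH3U (i + j) * powUp ETAL ETAU (-j) ≤ (G2 : ℚ) / N) :
    (N : ℝ) * uS [a, b, c] (xs false K M cs.w x) +
      -(G1 : ℝ) * lin (fun τ => ind (τ.rho [a, b, c] (others3 a b c f).1)) (xs false K M cs.w x) +
      -(G2 : ℝ) * lin (fun τ => ind (τ.rho [a, b, c] (others3 a b c f).2)) (xs false K M cs.w x) ≤ H := by
  have hx := L.nonneg
  obtain ⟨hB2, hB3, hB4⟩ := L.budgets
  obtain ⟨hc, hql, hqu, hq2, hn⟩ := c3_facts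
  simp only [uS, lin_xs]
  have hK : 0 ≤ Mtop K ^ (3 - (3 + Real.sqrt 3) / 2) := Real.rpow_nonneg (Mtop_pos K).le _
  have hC : (Mtop K ^ (3 - (3 + Real.sqrt 3) / 2) * 2) ^ ((3 + Real.sqrt 3) / 2)⁻¹ ≤
      (((PKind.rel3 a b c f).Cu K : ℚ) : ℝ) := by
    rw [Real.mul_rpow hK (by norm_num)]
    have h := scaled_const_le (n := 3) (Mtop_pos K) le_rfl hc hn (by decide +kernel) theta3_bounds.1 theta3_bounds.2 (k := K)
    have h2 := (R_pow_le theta3_bounds.2).1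
    simp only [PKind.Cu]
    push_cast at h h2 ⊢
    exact mul_le_mul h h2 (by positivity) ((by positivity : (0:ℝ) ≤ (Mtop K ^ ((3:ℝ) - (3 + Real.sqrt 3) / 2)) ^
      ((3 + Real.sqrt 3) / 2)⁻¹).trans (by exact_mod_cast h))
  have hab' : a ≠ b := Nat.ne_of_lt hab
  have hbc' : b ≠ c := Nat.ne_of_lt hbc
  have hac' : a ≠ c := Nat.ne_of_lt (hab.trans hbc)
  set ρ : ℕ → ℝ := fun t => lin (fun τ => ind (τ.rho [a, b, c] t)) x with hρ
  have ρ0 : ∀ t, 0 ≤ ρ t := fun t => lin_ind_nonneg _ hx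
  have row0 := L.isoR a ha b hb c hc' hab' hac' hbc'
  have hρf : ρ f ≤ 2 := by
    rcases hf with rfl | rfl | rfl
    · exact rho3_le_two x hx L.norm hB2 hB3 hB4 ha hb hc' hab hbc ha hb (Or.inl rfl) (Or.inr (Or.inl rfl)) (by omega)
    · exact rho3_le_two x hx L.norm hB2 hB3 hB4 ha hb hc' hab hbc hb ha (Or.inr (Or.inl rfl)) (Or.inl rfl) (by omega)
    · exact rho3_le_two x hx L.norm hB2 hB3 hB4 ha hb hc' hab hbc hc' ha (Or.inr (Or.inr rfl)) (Or.inl rfl) (by omega)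
  have row : uS [a, b, c] x ^ ((3 + Real.sqrt 3) / 2) ≤ M ^ (3 - (3 + Real.sqrt 3) / 2) * ρ f *
      ρ (others3 a b c f).1 * ρ (others3 a b c f).2 := by
    rcases hf with rfl | rfl | rfl
    · simpa [others3, hρ] using row0
    · have e : others3 a f c f = (a, c) := by simp [others3, hab'.symm]
      rw [e]; calc _ ≤ _ := row0
        _ = _ := by simp only [hρ]; ring
    · have e : others3 a b f f = (a, b) := by simp [others3, hac'.symm, hbc'.symm]
      rw [e]; calc _ ≤ _ := row0
        _ = _ := by simp only [hρ]; ring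
  exact scut L.Mpos L.Mle hc s0_exponents.1 (lin_ind_nonneg _ hx) (ρ0 _) (ρ0 _) (ρ0 f) hρf hql hqu hq2 row hC
    (supp_pow_le (by decide +kernel) theta3_bounds.1 theta3_bounds.2 i j) hN c1 c2 c3

/-- ISO₄ cut for the scaled law (two factors `S_z+T_z ≤ 2`). -/
theorem stan_iso4 (L : SLaw K cs M x) {a b : ℕ} (ha : a ∈ [1, 2, 3, 4]) (hb : b ∈ [1, 2, 3, 4]) (hab : a < b)
    {i j : ℤ} {N G1 G2 : ℕ} {H : ℚ} (hN : 0 < N)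
    (c1 : (PKind.iso4 a b).Cu K * powUp TH4L TH4U (i + j) * (1 - 2 * QL4) ≤ H / N)
    (c2 : (PKind.iso4 a b).Cu K * QU4 * powUp TH4L TH4U (i + j) * powUp ETAL ETAU (-i) ≤ (G1 : ℚ) / N)
    (c3 : (PKind.iso4 a b).Cu K * QU4 * powUp TH4L TH4U (i + j) * powUp ETAL ETAU (-j) ≤ (G2 : ℚ) / N) :
    (N : ℝ) * uS [1, 2, 3, 4] (xs false K M cs.w x) + -(G1 : ℝ) * (Sm a (xs false K M cs.w x) + Tm a (xs false K M cs.w x)) +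
      -(G2 : ℝ) * (Sm b (xs false K M cs.w x) + Tm b (xs false K M cs.w x)) ≤ H := by
  have hx := L.nonneg
  obtain ⟨hB2, hB3, hB4⟩ := L.budgets
  obtain ⟨hc, hql, hqu, hq2, hn⟩ := c4_facts
  simp only [uS, Sm, Tm, lin_xs, ← mul_add]
  have hK : 0 ≤ Mtop K ^ (4 - (3 + Real.sqrt (11 / 3)) / 2) := Real.rpow_nonneg (Mtop_pos K).le _
  have hC : (Mtop K ^ (4 - (3 + Real.sqrt (11 / 3)) / 2) * 4) ^ ((3 + Real.sqrt (11 / 3)) / 2)⁻¹ ≤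
      (((PKind.iso4 a b).Cu K : ℚ) : ℝ) := by
    rw [Real.mul_rpow hK (by norm_num)]
    have h := scaled_const_le (n := 4) (Mtop_pos K) le_rfl hc hn (by decide +kernel) theta4_bounds.1 theta4_bounds.2 (k := K)
    have h2 := (R_pow_le theta4_bounds.2).2
    simp only [PKind.Cu]
    push_cast at h h2 ⊢
    exact mul_le_mul h h2 (by positivity) ((by positivity : (0:ℝ) ≤ (Mtop K ^ ((4:ℝ) - (3 + Real.sqrt (11 / 3)) / 2)) ^
      ((3 + Real.sqrt (11 / 3)) / 2)⁻¹).trans (by exact_mod_cast h))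
  set st : ℕ → ℝ := fun z => Sm z x + Tm z x with hst
  have st0 : ∀ z ∈ [1, 2, 3, 4], 0 ≤ st z := fun z _ => add_nonneg (lin_ind_nonneg _ hx) (lin_ind_nonneg _ hx)
  have st2 := st_le_two x hx L.norm hB2 hB3 hB4
  have hπ := prod4_le st st0 st2 ha hb hab
  have row : uS [1, 2, 3, 4] x ^ ((3 + Real.sqrt (11 / 3)) / 2) ≤
      M ^ (4 - (3 + Real.sqrt (11 / 3)) / 2) * 4 * st a * st b := by
    have hK' : 0 ≤ M ^ (4 - (3 + Real.sqrt (11 / 3)) / 2) := Real.rpow_nonneg L.Mpos.le _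
    calc _ ≤ M ^ (4 - (3 + Real.sqrt (11 / 3)) / 2) * (st 1 * st 2 * st 3 * st 4) := by
          have h := L.iso4; simp only [hst]; linarith [h]
      _ ≤ M ^ (4 - (3 + Real.sqrt (11 / 3)) / 2) * (4 * st a * st b) := mul_le_mul_of_nonneg_left hπ hK'
      _ = _ := by ring
  have h := scut L.Mpos L.Mle hc s0_exponents.2.1 (lin_ind_nonneg _ hx) (st0 a ha) (st0 b hb) (by norm_num) le_rfl hql hqu hq2
    row hC (supp_pow_le (by decide +kernel) theta4_bounds.1 theta4_bounds.2 i j) hN c1 c2 c3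
  simp only [hst, Sm, Tm] at h
  exact h

/-- Hub ISO₄ cut for the scaled law (`ρ₀`, `ρ_f ≤ 1`). -/
theorem stan_hub4 (L : SLaw K cs M x) {a b c f : ℕ} (ha : a ∈ [1, 2, 3, 4]) (hb : b ∈ [1, 2, 3, 4])
    (hc' : c ∈ [1, 2, 3, 4]) (hab : a < b) (hbc : b < c) (hf : f = a ∨ f = b ∨ f = c)
    {i j : ℤ} {N G1 G2 : ℕ} {H : ℚ} (hN : 0 < N)
    (c1 : (PKind.hub4 a b c f).Cu K * powUp TH4L TH4U (i + j) * (1 - 2 * QL4) ≤ H / N)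
    (c2 : (PKind.hub4 a b c f).Cu K * QU4 * powUp TH4L TH4U (i + j) * powUp ETAL ETAU (-i) ≤ (G1 : ℚ) / N)
    (c3 : (PKind.hub4 a b c f).Cu K * QU4 * powUp TH4L TH4U (i + j) * powUp ETAL ETAU (-j) ≤ (G2 : ℚ) / N) :
    (N : ℝ) * uS [0, a, b, c] (xs false K M cs.w x) +
      -(G1 : ℝ) * lin (fun τ => ind (τ.rho [0, a, b, c] (others3 a b c f).1)) (xs false K M cs.w x) +
      -(G2 : ℝ) * lin (fun τ => ind (τ.rho [0, a, b, c] (others3 a b c f).2)) (xs false K M cs.w x) ≤ H := by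
  have hx := L.nonneg
  obtain ⟨hB2, hB3, hB4⟩ := L.budgets
  obtain ⟨hc, hql, hqu, hq2, hn⟩ := c4_facts
  simp only [uS, lin_xs]
  have hC : (Mtop K ^ (4 - (3 + Real.sqrt (11 / 3)) / 2) * 1) ^ ((3 + Real.sqrt (11 / 3)) / 2)⁻¹ ≤
      (((PKind.hub4 a b c f).Cu K : ℚ) : ℝ) := by
    rw [mul_one]
    have h := scaled_const_le (n := 4) (Mtop_pos K) le_rfl hc hn (by decide +kernel) theta4_bounds.1 theta4_bounds.2 (k := K)
    simp only [PKind.Cu]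
    exact_mod_cast h
  have hS : [0, a, b, c] ∈ [[0, 1, 2, 3], [0, 1, 2, 4], [0, 1, 3, 4], [0, 2, 3, 4], [0, 1, 2, 3, 4]] := by
    simp only [List.mem_cons, List.not_mem_nil, or_false] at ha hb hc'
    rcases ha with rfl | rfl | rfl | rfl <;> rcases hb with rfl | rfl | rfl | rfl <;> rcases hc' with rfl | rfl | rfl | rfl <;>
      first | omega | simp
  obtain ⟨hρt, hρ0⟩ := rho_hubset_le_one x hx L.norm hB2 hB3 hB4 hS
  set ρ : ℕ → ℝ := fun t => lin (fun τ => ind (τ.rho [0, a, b, c] t)) x with hρ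
  have ρ0 : ∀ t, 0 ≤ ρ t := fun t => lin_ind_nonneg _ hx
  have hf' : f ∈ [1, 2, 3, 4] := by rcases hf with rfl | rfl | rfl <;> assumption
  have hfS : f ∈ [0, a, b, c] := by rcases hf with rfl | rfl | rfl <;> simp
  have hF : ρ 0 * ρ f ≤ 1 := by
    calc ρ 0 * ρ f ≤ 1 * 1 := mul_le_mul hρ0 (hρt f hf' hfS) (ρ0 f) (by norm_num)
      _ = 1 := by norm_num
  have row0 := L.isoH4 a ha b hb c hc' (Nat.ne_of_lt hab) (Nat.ne_of_lt (hab.trans hbc)) (Nat.ne_of_lt hbc)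
  have row : uS [0, a, b, c] x ^ ((3 + Real.sqrt (11 / 3)) / 2) ≤ M ^ (4 - (3 + Real.sqrt (11 / 3)) / 2) * (ρ 0 * ρ f) *
      ρ (others3 a b c f).1 * ρ (others3 a b c f).2 := by
    have hab' : a ≠ b := Nat.ne_of_lt hab
    have hbc' : b ≠ c := Nat.ne_of_lt hbc
    have hac' : a ≠ c := Nat.ne_of_lt (hab.trans hbc)
    rcases hf with rfl | rfl | rfl
    · have e : others3 f b c f = (b, c) := by simp [others3]
      rw [e]; calc _ ≤ _ := row0
        _ = _ := by simp only [hρ]; ring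
    · have e : others3 a f c f = (a, c) := by simp [others3, hab'.symm]
      rw [e]; calc _ ≤ _ := row0
        _ = _ := by simp only [hρ]; ring
    · have e : others3 a b f f = (a, b) := by simp [others3, hac'.symm, hbc'.symm]
      rw [e]; calc _ ≤ _ := row0
        _ = _ := by simp only [hρ]; ring
  exact scut L.Mpos L.Mle hc s0_exponents.2.1 (lin_ind_nonneg _ hx) (ρ0 _) (ρ0 _) (mul_nonneg (ρ0 0) (ρ0 f)) hF hql hqu hq2
    row hC (supp_pow_le (by decide +kernel) theta4_bounds.1 theta4_bounds.2 i j) hN c1 c2 c3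

/-- ISO₅ cut for the scaled law (`ρ₀` and two relay supports `≤ 1`). -/
theorem stan_iso5 (L : SLaw K cs M x) {a b : ℕ} (ha : a ∈ [1, 2, 3, 4]) (hb : b ∈ [1, 2, 3, 4]) (hab : a < b)
    {i j : ℤ} {N G1 G2 : ℕ} {H : ℚ} (hN : 0 < N)
    (c1 : (PKind.iso5 a b).Cu K * powUp LAML LAMU (i + j) * (1 - 2 * (2 / 5 : ℚ)) ≤ H / N)
    (c2 : (PKind.iso5 a b).Cu K * (2 / 5 : ℚ) * powUp LAML LAMU (i + j) * powUp ETAL ETAU (-i) ≤ (G1 : ℚ) / N)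
    (c3 : (PKind.iso5 a b).Cu K * (2 / 5 : ℚ) * powUp LAML LAMU (i + j) * powUp ETAL ETAU (-j) ≤ (G2 : ℚ) / N) :
    (N : ℝ) * uS [0, 1, 2, 3, 4] (xs false K M cs.w x) +
      -(G1 : ℝ) * lin (fun τ => ind (τ.rho [0, 1, 2, 3, 4] a)) (xs false K M cs.w x) +
      -(G2 : ℝ) * lin (fun τ => ind (τ.rho [0, 1, 2, 3, 4] b)) (xs false K M cs.w x) ≤ H := by
  have hx := L.nonneg
  obtain ⟨hB2, hB3, hB4⟩ := L.budgets
  obtain ⟨hc, hql, hqu, hq2⟩ := c5_facts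
  simp only [uS, lin_xs]
  have hC : (Mtop K ^ ((5 : ℝ) / 2) * 1) ^ ((5 : ℝ) / 2)⁻¹ ≤ (((PKind.iso5 a b).Cu K : ℚ) : ℝ) := by
    rw [mul_one]; simp only [PKind.Cu]; exact iso5_const_le (Mtop_pos K) le_rfl
  obtain ⟨hρt, hρ0⟩ := rho_hubset_le_one x hx L.norm hB2 hB3 hB4 (S := [0, 1, 2, 3, 4]) (by simp)
  set ρ : ℕ → ℝ := fun t => lin (fun τ => ind (τ.rho [0, 1, 2, 3, 4] t)) x with hρ
  have ρ0 : ∀ t, 0 ≤ ρ t := fun t => lin_ind_nonneg _ hx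
  have ρ1 : ∀ t ∈ [1, 2, 3, 4], ρ t ≤ 1 := fun t ht => hρt t ht (by
    simp only [List.mem_cons, List.not_mem_nil, or_false] at ht; rcases ht with rfl | rfl | rfl | rfl <;> simp)
  have P3 : ∀ {p q r : ℝ}, 0 ≤ p → 0 ≤ q → 0 ≤ r → p ≤ 1 → q ≤ 1 → r ≤ 1 → p * q * r ≤ 1 := by
    intro p q r hp hq hr hp1 hq1 hr1
    have h1 : p * q ≤ 1 * 1 := mul_le_mul hp1 hq1 hq (by norm_num)
    calc p * q * r ≤ 1 * 1 * 1 := mul_le_mul (by linarith) hr1 hr (by norm_num)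
      _ = 1 := by norm_num
  have row0 := L.iso5
  have k0 := hρ0; have k1 := ρ1 1 (by simp); have k2 := ρ1 2 (by simp); have k3 := ρ1 3 (by simp); have k4 := ρ1 4 (by simp)
  simp only [List.mem_cons, List.not_mem_nil, or_false] at ha hb
  have key : ∃ F : ℝ, 0 ≤ F ∧ F ≤ 1 ∧
      uS [0, 1, 2, 3, 4] x ^ ((5 : ℝ) / 2) ≤ M ^ ((5 : ℝ) / 2) * F * ρ a * ρ b := by
    rcases ha with rfl | rfl | rfl | rfl <;> rcases hb with rfl | rfl | rfl | rfl <;> (try omega)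
    · exact ⟨ρ 0 * ρ 3 * ρ 4, mul_nonneg (mul_nonneg (ρ0 0) (ρ0 3)) (ρ0 4), P3 (ρ0 0) (ρ0 3) (ρ0 4) k0 k3 k4, by
        calc _ ≤ _ := row0
          _ = _ := by simp only [hρ]; ring⟩
    · exact ⟨ρ 0 * ρ 2 * ρ 4, mul_nonneg (mul_nonneg (ρ0 0) (ρ0 2)) (ρ0 4), P3 (ρ0 0) (ρ0 2) (ρ0 4) k0 k2 k4, by
        calc _ ≤ _ := row0
          _ = _ := by simp only [hρ]; ring⟩
    · exact ⟨ρ 0 * ρ 2 * ρ 3, mul_nonneg (mul_nonneg (ρ0 0) (ρ0 2)) (ρ0 3), P3 (ρ0 0) (ρ0 2) (ρ0 3) k0 k2 k3, by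
        calc _ ≤ _ := row0
          _ = _ := by simp only [hρ]; ring⟩
    · exact ⟨ρ 0 * ρ 1 * ρ 4, mul_nonneg (mul_nonneg (ρ0 0) (ρ0 1)) (ρ0 4), P3 (ρ0 0) (ρ0 1) (ρ0 4) k0 k1 k4, by
        calc _ ≤ _ := row0
          _ = _ := by simp only [hρ]; ring⟩
    · exact ⟨ρ 0 * ρ 1 * ρ 3, mul_nonneg (mul_nonneg (ρ0 0) (ρ0 1)) (ρ0 3), P3 (ρ0 0) (ρ0 1) (ρ0 3) k0 k1 k3, by
        calc _ ≤ _ := row0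
          _ = _ := by simp only [hρ]; ring⟩
    · exact ⟨ρ 0 * ρ 1 * ρ 2, mul_nonneg (mul_nonneg (ρ0 0) (ρ0 1)) (ρ0 2), P3 (ρ0 0) (ρ0 1) (ρ0 2) k0 k1 k2, by
        calc _ ≤ _ := row0
          _ = _ := by simp only [hρ]; ring⟩
  obtain ⟨F, hF0, hF1, row⟩ := key
  exact scut L.Mpos L.Mle hc s0_exponents.2.2 (lin_ind_nonneg _ hx) (ρ0 _) (ρ0 _) hF0 hF1 hql hqu hq2 row hC
    (supp_pow_le (by decide +kernel) lam_bounds.1 lam_bounds.2 i j) hN c1 c2 c3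

/-- **Tangent rows for the scaled law.**  Every template-B tangent row accepted by `TRow.ok K` holds for `x̂ = Λx`. -/
theorem trow_valid_scaled (L : SLaw K cs M x) (r : TRow) (hr : r.ok K = true) :
    lin r.toRow.φ (xs false K M cs.w x) ≤ (r.toRow.b : ℝ) := by
  obtain ⟨κ, i, j, N, G1, G2, H⟩ := r
  simp only [TRow.ok, Bool.and_eq_true, decide_eq_true_eq] at hr
  obtain ⟨⟨⟨⟨hk, hN⟩, c1⟩, c2⟩, c3⟩ := hr
  cases κ with
  | hub3 a b =>
    simp only [PKind.ok, Bool.and_eq_true, decide_eq_true_eq] at hk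
    obtain ⟨⟨ha, hb⟩, hab⟩ := hk
    simp only [PKind.QL, PKind.QU, PKind.Pu] at c1 c2 c3
    have h := stan_hub3 L ha hb hab hN c1 c2 c3
    simp only [TRow.toRow, lin_combo, List.map_cons, List.map_nil, List.sum_cons, List.sum_nil, PKind.uφ,
      PKind.s1φ, PKind.s2φ, uS, Pim] at h ⊢
    push_cast at h ⊢
    linarith
  | rel3 a b c f =>
    simp only [PKind.ok, Bool.and_eq_true, Bool.or_eq_true, decide_eq_true_eq] at hk
    obtain ⟨⟨⟨⟨⟨ha, hb⟩, hc⟩, hab⟩, hbc⟩, hf⟩ := hk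
    simp only [PKind.QL, PKind.QU, PKind.Pu] at c1 c2 c3
    have h := stan_rel3 L ha hb hc hab hbc (or_assoc.mp hf) hN c1 c2 c3
    simp only [TRow.toRow, lin_combo, List.map_cons, List.map_nil, List.sum_cons, List.sum_nil, PKind.uφ,
      PKind.s1φ, PKind.s2φ, uS] at h ⊢
    push_cast at h ⊢
    linarith
  | iso4 a b =>
    simp only [PKind.ok, Bool.and_eq_true, decide_eq_true_eq] at hk
    obtain ⟨⟨ha, hb⟩, hab⟩ := hk
    simp only [PKind.QL, PKind.QU, PKind.Pu] at c1 c2 c3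
    have h := stan_iso4 L ha hb hab hN c1 c2 c3
    simp only [TRow.toRow, lin_combo, List.map_cons, List.map_nil, List.sum_cons, List.sum_nil, PKind.uφ,
      PKind.s1φ, PKind.s2φ, uS, Sm, Tm] at h ⊢
    push_cast at h ⊢
    linarith
  | hub4 a b c f =>
    simp only [PKind.ok, Bool.and_eq_true, Bool.or_eq_true, decide_eq_true_eq] at hk
    obtain ⟨⟨⟨⟨⟨ha, hb⟩, hc⟩, hab⟩, hbc⟩, hf⟩ := hk
    simp only [PKind.QL, PKind.QU, PKind.Pu] at c1 c2 c3
    have h := stan_hub4 L ha hb hc hab hbc (or_assoc.mp hf) hN c1 c2 c3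
    simp only [TRow.toRow, lin_combo, List.map_cons, List.map_nil, List.sum_cons, List.sum_nil, PKind.uφ,
      PKind.s1φ, PKind.s2φ, uS] at h ⊢
    push_cast at h ⊢
    linarith
  | iso5 a b =>
    simp only [PKind.ok, Bool.and_eq_true, decide_eq_true_eq] at hk
    obtain ⟨⟨ha, hb⟩, hab⟩ := hk
    simp only [PKind.QL, PKind.QU, PKind.Pu] at c1 c2 c3
    have h := stan_iso5 L ha hb hab hN c1 c2 c3
    simp only [TRow.toRow, lin_combo, List.map_cons, List.map_nil, List.sum_cons, List.sum_nil, PKind.uφ,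
      PKind.s1φ, PKind.s2φ, uS] at h ⊢
    push_cast at h ⊢
    linarith

end

end TypeTable
end HubOnly

end Summit.CriticalPhenomena.PercolationContinuityZ3.Theorems
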